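import Summits.QuantumFields.YangMills.Theorems.UnitScaleTiltProp7SectET3H137RowsT3
import Summits.QuantumFields.YangMills.Theorems.UnitScaleTiltProp7SecondOrderDictT3
import HarnessLib

/-!
# Route `UnitScaleTilt`, crux «MinimiserStabilityRegPr» (stmt-QuantumFields-19200, stub EX), node N06(d = 3), route (α) — LAYER 0, ROWS (def-free):
# **THE (S)-SUB-ROW `hΔH` = [Balaban1985Variational] (137)–(140) FOR THE LETTER OF RECORD `H46`, REDUCED TO NAMED ROWS** — the two second-order members of
# (19) ∕ `Prop7TPrint.nMax19` for `X := H46 … U₀ Y`, `‖D¹*_{U₀}D¹_{U₀}(H46 Y)‖, ‖Δ¹_{U₀}(H46 Y)‖ ≤ BH″·η³·‖Y‖`, FROM the operator identities (137)+(138)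
# (✓`Prop7SectET3H137Rows`), the order-2 dictionary ∕ (135) (✓`Prop7SecondOrderDict`), and FOUR DISPLAYED print rows: the sup size of the (137) right side
# (`Q_k†`, `(QGQ*)⁻¹`), print's (139) «`|Δ′_πHB|₍₋₃₎ ≤ O(1)|B|`», print's (3.10)+(3.69) «`Δ^η = D*D + Δ′`, `Δ′` bounded», and print's (140)-step «`DD*HB = DPD*HB`,
# `DPD*` bounded (3.49)» — each a NAMED hypothesis with its print locus (nothing of [Balaban1985BackgroundPropagators] §3 is asserted)

Cell `ym3-torus`, width seat `ym3-torus-px5` (gen 0; FILL-TO-CAP «width 5»; (S)-sub-row `hΔH` of ★★OWNER ym3-torus-plan g27 RULING №7 (3); shape confirmed by the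
EX-knit namer ★ym-ust-19200-w2 g5 2026-08-28 16:31:19Z (3), GO-gating rule (G4) 16:38:05Z «the untyped bounds (139)∕(3.49)∕(3.69) displayed as named rows, not smuggled»;
LOCATE memo `HOME/ym3-torus-px5/LOCATE-HDH-137-140-px5.md` = stmt-QuantumFields-19200 evidence #56).  THEOREMS ONLY (0 `def`, 0 `sorry`); `--supports
stmt-QuantumFields-19200 --as helper`; count-neutral.  YM₃ on T³ is ladder rung R3, NOT the Clay problem; nothing here is a claim about a stub, a crux, d = 4 or the mass gap.

THE PRINT.  [Balaban1985Variational] pp. 298–299: *«We have to prove that the operator H has better regularity properties than these described in (3.133) [5], especially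
D*DH, Δ_{U₀}H are bounded in the norm |·|₍₋₃₎. Indeed, (3.126) [5] yields Δ_πH = … = Q*(QGQ*)⁻¹(L^{j(·)}η)⁻¹ − Q*a(L^{j(·)}η)⁻¹, (137) hence |Δ_πHB|₍₋₃₎ ≦ O(1)|B|. … The
properties of HB and J imply the bound |Δ′_πHB|₍₋₃₎ ≦ O(1)|B|, hence |ΔHB|₍₋₃₎ ≦ O(1)|B|. (139) Finally we use the decomposition (3.10) [5], i.e. Δ = D*D + Δ′, Δ′ is a local,
bounded operator satisfying the bound |Δ′HB|₍₋₃₎ ≦ O(ε₁)|B|. This implies the bound |D*DHB|₍₋₃₎ ≦ O(1)|B| … To get a bound for Δ_{U₀}HB, we write D*DHB = (D*D + DRD*)HB =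
(D*D + DD*)HB − DPD*HB, (140) and we use again the formula (135), and the fact that DPD* is a bounded operator. This gives the bound |Δ_{U₀}HB|₍₋₃₎ ≦ O(1)|B|.»*
AT THE T³ MEMBER all (−3)-level weights are `1` (one level; `L^kη = 1`); the route letter is `H46 = η·H_print` (✓`Prop7SectET3CurvedPropagators.Hf`), and the `nMax19`
members are the UNIT-spacing operators `D¹ = ηD^η` (✓`T3SectALandauChart` §2.1) — hence the target size `η·η²·O(1) = BH″·η³` per unit block norm of `Y`.

THE DISPLAYED ROWS (hypotheses, by name; each with its inhabitability line per ★★OWNER RULING g27-№9 (3)):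
* `h46`   — (46)₀ `‖H46 Y b‖ ≤ BH·η·‖Y‖` [the EX display's `h46₀` member for the letter; inhabited by the (3.133) n = 0 reading ✓`Prop7SectET3NormHRowAtOpsT3.normH₁_row_at_opsT3` ∕ KH1 lineage].
* `h137`  — the (137) right side is sup-bounded: `‖toL2⁻¹(Q_k†((QGQ*)⁻¹Ỹ) − Q_k†(a·Ỹ)) b‖ ≤ c₁₃₇·‖Y‖`, `Ỹ = toL2B Y` [print «hence |Δ_πHB|₍₋₃₎ ≦ O(1)|B|»; inhabited by the
  block-diagonal sup letter of `Q_k†` (explicit) × the sup row of `(QGQ*)⁻¹` — [Balaban1985BackgroundPropagators] Thm 3.11∕(3.126), L² form ✓`B9Eq3126ConjugatedQG1QInv`, sup form the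
  `B9Eq349ConjugatedQGGQInv*` letters at the member: N06-class].
* `h139`  — print's (139), first half, for the route letter: `‖toL2⁻¹((DG′R_SD*)†(Δ^η(toL2 (H46 Y)))) b‖ ≤ c₁₃₉·η·‖Y‖` [«|Δ′_πHB|₍₋₃₎ ≦ O(1)|B|»; inhabited by (138)
  ✓`B11Eq138Polarization.eq138_deltaPi_torus` + «G′RD* bounded in |·|₍₁₎» (`B9Eq349ConjugatedGreenLetters` species) + `|J| ≤ O(ε₀)` (✓`B11Eq98CurrentSlot.norm_Jcur_le`) + (46): N06-class;
  that `Δ′_π(Hω)` IS this transposed gauge correction is ✓`Prop7SectET3H137Rows.DeltaEta_HT`].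
* `h310`  — print's (3.10) with (3.69)∕(14) at the member: `‖toL2⁻¹(Δ^η(toL2 X)) b − η⁻²·(D¹*_{U₀}D¹_{U₀}X)(b)‖ ≤ c₃₆₉·ε₀·s` whenever `‖X b′‖ ≤ s` [«Δ = D*D + Δ′, Δ′ local, bounded,
  |Δ′HB| ≦ O(ε₁)|B|»; inhabited by the explicit second-derivative formula (3.7)∕(3.10) for brick L0b's `DeltaEta` (lit ✓`B9Eq310DeltaPrime` as a form) + ✓`B9Eq369CurvOpSupLetter` with the
  plaquette clause of `RegPr ε₀` (`|U₀(∂p) − 1| < ε₀η²` against the `η⁻²` of `Δ′^η`): N06-class, the «(3.10)-explicit» row of the LOCATE memo §4 (D2)].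
* `h349`  — the (140) step for the route letter: `‖D¹_{U₀}(D¹*_{U₀}(H46 Y))‖ ≤ c₃₄₉·η³·‖Y‖` [«DD*HB = DPD*HB» by (45)₂ `R_SD*H = 0` (✓`Prop7SectET3DeltaPi.landauS_H46`) and «DPD* is a
  bounded operator» (3.49) (`B9Eq349DPBlockDecayLetters` species) × (46)₀: N06-class].

WHAT IS PROVED (member `F`, `h : n ≤ K`, parameters `c₀ cB a`, background `U₀` with `RegPr F n K ε₀ U₀`, `PosOnto … (DeltaPiSlot …) U₀`, `PosPrime … U₀`;
ns `…Theorems.Prop7SectET3HDeltaHOfRows`).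
* §1 ★★ `norm_symm_DeltaEta_toL2_H46_le` — «|ΔHB|₍₋₃₎ ≦ O(1)|B|» for the route letter: `‖toL2⁻¹(Δ^η(toL2 (H46 Y))) b‖ ≤ (c₁₃₇ + c₁₃₉)·η·‖Y‖` from (137)+(138)
  (✓`DeltaEta_toL2_H46`) + `h137` + `h139`.
* §2 ★★★ `covCodiffCurlT_H46_le` — «|D*DHB|₍₋₃₎ ≦ O(1)|B|»: `‖D¹*_{U₀}D¹_{U₀}(H46 Y)‖ ≤ (c₁₃₇ + c₁₃₉ + c₃₆₉·ε₀·BH)·η³·‖Y‖` (§1 + `h310` + `h46`).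
* §3 ★★★ `covLapFormT_H46_le` — «|Δ_{U₀}HB|₍₋₃₎ ≦ O(1)|B|»: `‖Δ¹_{U₀}(H46 Y)‖ ≤ (c₁₃₇ + c₁₃₉ + c₃₆₉·ε₀·BH + c₃₄₉ + 4·ε₀·BH)·η³·‖Y‖` (§2 + (135) in the `nMax19` letters
  ✓`Prop7SecondOrderDict.norm_covCodiffCurlT_sub_covLapFormT_add_gradDiv_le_of_regPr` + `h349` + `h46`).
* §4 ★★★ `hΔH_of_rows` — THE ROW: both members with ONE constant `BH″ := c₁₃₇ + c₁₃₉ + c₃₄₉ + (c₃₆₉ + 4)·ε₀·BH`, in the two-conjunct shape confirmed by the namer.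
HONEST SCOPE.  Bookkeeping: two triangle inequalities and one scalar exchange `η⁻²` ↔ `η²` over the landed identities; the four displayed rows ARE print's inputs (137)-sup ∕ (139) ∕
(3.10)+(3.69) ∕ (140)+(3.49) and are NOT proved here — this file REDUCES `hΔH` to them (the (S)-sub-row made precise), it does not discharge N06(d = 3).  No positivity proved; nothing
continuum ∕ OS ∕ mass-gap ∕ Clay.

References: T. Bałaban, CMP **102** (1985) 277–309 [Balaban1985Variational] ((19) p.281, (45)–(46) p.285, (135)–(140) pp.298–299); CMP **99** (1985) 389–434
[Balaban1985BackgroundPropagators] ((3.10) p.392, (3.49) p.399, (3.69) p.404, (3.119)–(3.126) pp.419–420).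
-/

set_option autoImplicit false

noncomputable section

open scoped InnerProductSpace ComplexConjugate Matrix.Norms.L2Operator

namespace Summit.QuantumFields.YangMills.Theorems.Prop7SectET3HDeltaHOfRows

open Literature.MathematicalPhysics.QuantumFieldTheory.Balaban1983to89
open Literature.MathematicalPhysics.QuantumFieldTheory.Balaban1983to89.T3ContinuumYM3Torus
open Literature.MathematicalPhysics.QuantumFieldTheory.Balaban1983to89.T3PrintedRegularMinimiser (RegPr)
open T3SectALandauChart (covDerivFwdT covCodiffCurlT covLapFormT covDivFormT bgUnits eta eta_pos)
open B9SectCLatticeCarrier (Bond)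
open B9Eq311L2Pairing (WL2)
open B11Eq103H1Complex (SiteL2K BondL2K)
open Summit.QuantumFields.YangMills.Theorems.Prop7SectET3Transport (periodsT3)
open Summit.QuantumFields.YangMills.Theorems.Prop7SectET3HilbertLetters (W₂ toL2 toL2B DL2 DstarL2)
open Summit.QuantumFields.YangMills.Theorems.Prop7SectET3GaugeProjector (RS)
open Summit.QuantumFields.YangMills.Theorems.Prop7SectET3WilsonHessian (DeltaEta)
open Summit.QuantumFields.YangMills.Theorems.Prop7SectET3CurvedPropagators
open Summit.QuantumFields.YangMills.Theorems.Prop7SectET3DeltaPi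
open Summit.QuantumFields.YangMills.Theorems.Prop7SectET3H137Rows (DeltaEta_toL2_H46)
open Summit.QuantumFields.YangMills.Theorems.Prop7SecondOrderDict (norm_covCodiffCurlT_sub_covLapFormT_add_gradDiv_le_of_regPr)

variable {F : T3Family} {n K : ℕ} {h : n ≤ K} {c₀ cB a : ℝ} [Fact (0 < c₀)] [Fact (0 < cB)]

/-! ## §1 «|ΔHB|₍₋₃₎ ≦ O(1)|B|» for the route letter, from (137)+(138) and the two sup rows -/

/-- ★★ **`‖toL2⁻¹(Δ^η(toL2 (H46 Y))) b‖ ≤ (c₁₃₇ + c₁₃₉)·η·‖Y‖`** — print's (139) «|ΔHB|₍₋₃₎ ≦ O(1)|B|» for `H46 = η·H_print`, from the operator identity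
`Δ^η(toL2 (H46 Y)) = η•(Q_k†((QGQ*)⁻¹Ỹ) − Q_k†(a·Ỹ)) + (DG′R_SD*)†(Δ^η(toL2 (H46 Y)))` (✓`DeltaEta_toL2_H46`) and the displayed sup rows `h137`, `h139`.
[cite: Balaban1985Variational, (137)–(139) pp.298–299] -/
theorem norm_symm_DeltaEta_toL2_H46_le {U₀ : GaugeField (F.P K) 0 (Matrix.specialUnitaryGroup (Fin 2) ℂ)}
    (hp : PosOnto F n K h c₀ cB a (DeltaPiSlot F n K h c₀ cB a) U₀) (hq : PosPrime F n K h c₀ cB a U₀) {c137 c139 : ℝ}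
    (h137 : ∀ (Y : PBond (F.P n) 0 → Matrix (Fin 2) (Fin 2) ℂ) (b : PBond (F.P K) 0),
      ‖(toL2 F K c₀).symm (LinearMap.adjoint (Qk F n K h c₀ cB U₀) (KinvT F n K h c₀ cB a (DeltaPiSlot F n K h c₀ cB a) U₀ (toL2B F n cB Y))
          - LinearMap.adjoint (Qk F n K h c₀ cB U₀) (((a : ℂ)) • toL2B F n cB Y)) b‖ ≤ c137 * ‖Y‖)
    (h139 : ∀ (Y : PBond (F.P n) 0 → Matrix (Fin 2) (Fin 2) ℂ) (b : PBond (F.P K) 0),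
      ‖(toL2 F K c₀).symm (LinearMap.adjoint
          (DL2 F n K c₀ U₀ ∘ₗ GprimeT F n K h c₀ cB a U₀ ∘ₗ RS F n K h c₀ cB U₀ ∘ₗ DstarL2 F n K c₀ U₀)
          (DeltaEta F n K c₀ U₀ (toL2 F K c₀ (H46 F n K h c₀ cB a U₀ Y)))) b‖ ≤ c139 * eta F n K * ‖Y‖)
    (Y : PBond (F.P n) 0 → Matrix (Fin 2) (Fin 2) ℂ) (b : PBond (F.P K) 0) :
    ‖(toL2 F K c₀).symm (DeltaEta F n K c₀ U₀ (toL2 F K c₀ (H46 F n K h c₀ cB a U₀ Y))) b‖ ≤ (c137 + c139) * eta F n K * ‖Y‖ := by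
  have hη : 0 < eta F n K := eta_pos F n K
  have hid := DeltaEta_toL2_H46 (h := h) (c₀ := c₀) (cB := cB) (a := a) hp hq Y
  -- apply `toL2⁻¹` and evaluate at `b`
  have happ : (toL2 F K c₀).symm (DeltaEta F n K c₀ U₀ (toL2 F K c₀ (H46 F n K h c₀ cB a U₀ Y))) b
      = (((eta F n K : ℝ) : ℂ)) • (toL2 F K c₀).symm
            (LinearMap.adjoint (Qk F n K h c₀ cB U₀) (KinvT F n K h c₀ cB a (DeltaPiSlot F n K h c₀ cB a) U₀ (toL2B F n cB Y))
              - LinearMap.adjoint (Qk F n K h c₀ cB U₀) (((a : ℂ)) • toL2B F n cB Y)) b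
        + (toL2 F K c₀).symm (LinearMap.adjoint
            (DL2 F n K c₀ U₀ ∘ₗ GprimeT F n K h c₀ cB a U₀ ∘ₗ RS F n K h c₀ cB U₀ ∘ₗ DstarL2 F n K c₀ U₀)
            (DeltaEta F n K c₀ U₀ (toL2 F K c₀ (H46 F n K h c₀ cB a U₀ Y)))) b := by
    conv_lhs => rw [hid]
    rw [map_add, map_smul, Pi.add_apply, Pi.smul_apply]
  rw [happ]
  have hηn : ‖(((eta F n K : ℝ) : ℂ))‖ = eta F n K := by
    rw [Complex.norm_real, Real.norm_of_nonneg hη.le]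
  calc ‖(((eta F n K : ℝ) : ℂ)) • (toL2 F K c₀).symm
            (LinearMap.adjoint (Qk F n K h c₀ cB U₀) (KinvT F n K h c₀ cB a (DeltaPiSlot F n K h c₀ cB a) U₀ (toL2B F n cB Y))
              - LinearMap.adjoint (Qk F n K h c₀ cB U₀) (((a : ℂ)) • toL2B F n cB Y)) b
        + (toL2 F K c₀).symm (LinearMap.adjoint
            (DL2 F n K c₀ U₀ ∘ₗ GprimeT F n K h c₀ cB a U₀ ∘ₗ RS F n K h c₀ cB U₀ ∘ₗ DstarL2 F n K c₀ U₀)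
            (DeltaEta F n K c₀ U₀ (toL2 F K c₀ (H46 F n K h c₀ cB a U₀ Y)))) b‖
      ≤ ‖(((eta F n K : ℝ) : ℂ)) • (toL2 F K c₀).symm
            (LinearMap.adjoint (Qk F n K h c₀ cB U₀) (KinvT F n K h c₀ cB a (DeltaPiSlot F n K h c₀ cB a) U₀ (toL2B F n cB Y))
              - LinearMap.adjoint (Qk F n K h c₀ cB U₀) (((a : ℂ)) • toL2B F n cB Y)) b‖
        + ‖(toL2 F K c₀).symm (LinearMap.adjoint
            (DL2 F n K c₀ U₀ ∘ₗ GprimeT F n K h c₀ cB a U₀ ∘ₗ RS F n K h c₀ cB U₀ ∘ₗ DstarL2 F n K c₀ U₀)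
            (DeltaEta F n K c₀ U₀ (toL2 F K c₀ (H46 F n K h c₀ cB a U₀ Y)))) b‖ := norm_add_le _ _
    _ ≤ eta F n K * (c137 * ‖Y‖) + c139 * eta F n K * ‖Y‖ := by
        gcongr
        · rw [norm_smul, hηn]
          exact mul_le_mul_of_nonneg_left (h137 Y b) hη.le
        · exact h139 Y b
    _ = (c137 + c139) * eta F n K * ‖Y‖ := by ring

/-! ## §2 «|D*DHB|₍₋₃₎ ≦ O(1)|B|» — the first second-order member of (19) for `H46 Y` -/

/-- ★★★ **`‖D¹*_{U₀}D¹_{U₀}(H46 Y)‖ ≤ (c₁₃₇ + c₁₃₉ + c₃₆₉·ε₀·BH)·η³·‖Y‖`** — print's «|D*DHB|₍₋₃₎ ≦ O(1)|B|» (p. 299 l.9) for the route letter: §1 + the displayed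
(3.10)+(3.69) row `h310` (`Δ^η = η⁻²D¹*D¹ + Δ′`, `‖Δ′X‖ ≤ c₃₆₉ε₀·sup‖X‖`) + (46)₀ `h46`, and the scale exchange `η⁻² ↔ η²`.
[cite: Balaban1985Variational, (139) p.299, (19) p.281; Balaban1985BackgroundPropagators, (3.10) p.392, (3.69) p.404] -/
theorem covCodiffCurlT_H46_le {U₀ : GaugeField (F.P K) 0 (Matrix.specialUnitaryGroup (Fin 2) ℂ)}
    (hp : PosOnto F n K h c₀ cB a (DeltaPiSlot F n K h c₀ cB a) U₀) (hq : PosPrime F n K h c₀ cB a U₀) {ε₀ BH c137 c139 c369 : ℝ}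
    (h46 : ∀ (Y : PBond (F.P n) 0 → Matrix (Fin 2) (Fin 2) ℂ) (b : PBond (F.P K) 0), ‖H46 F n K h c₀ cB a U₀ Y b‖ ≤ BH * eta F n K * ‖Y‖)
    (h137 : ∀ (Y : PBond (F.P n) 0 → Matrix (Fin 2) (Fin 2) ℂ) (b : PBond (F.P K) 0),
      ‖(toL2 F K c₀).symm (LinearMap.adjoint (Qk F n K h c₀ cB U₀) (KinvT F n K h c₀ cB a (DeltaPiSlot F n K h c₀ cB a) U₀ (toL2B F n cB Y))
          - LinearMap.adjoint (Qk F n K h c₀ cB U₀) (((a : ℂ)) • toL2B F n cB Y)) b‖ ≤ c137 * ‖Y‖)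
    (h139 : ∀ (Y : PBond (F.P n) 0 → Matrix (Fin 2) (Fin 2) ℂ) (b : PBond (F.P K) 0),
      ‖(toL2 F K c₀).symm (LinearMap.adjoint
          (DL2 F n K c₀ U₀ ∘ₗ GprimeT F n K h c₀ cB a U₀ ∘ₗ RS F n K h c₀ cB U₀ ∘ₗ DstarL2 F n K c₀ U₀)
          (DeltaEta F n K c₀ U₀ (toL2 F K c₀ (H46 F n K h c₀ cB a U₀ Y)))) b‖ ≤ c139 * eta F n K * ‖Y‖)
    (h310 : ∀ (X : PBond (F.P K) 0 → Matrix (Fin 2) (Fin 2) ℂ) (s : ℝ), (∀ b, ‖X b‖ ≤ s) → ∀ b : PBond (F.P K) 0,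
      ‖(toL2 F K c₀).symm (DeltaEta F n K c₀ U₀ (toL2 F K c₀ X)) b
          - ((((eta F n K)⁻¹ ^ 2 : ℝ) : ℂ)) • covCodiffCurlT 1 (bgUnits F K U₀) X b.dir b.src‖ ≤ c369 * ε₀ * s)
    (Y : PBond (F.P n) 0 → Matrix (Fin 2) (Fin 2) ℂ) (μ : Fin (F.P K).d) (x : Site (F.P K) 0) :
    ‖covCodiffCurlT 1 (bgUnits F K U₀) (H46 F n K h c₀ cB a U₀ Y) μ x‖ ≤ (c137 + c139 + c369 * ε₀ * BH) * eta F n K ^ 3 * ‖Y‖ := by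
  have hη : 0 < eta F n K := eta_pos F n K
  set Fv := H46 F n K h c₀ cB a U₀ Y with hFv
  -- the Hessian row at the bond `⟨x, μ⟩` and the (3.10) row for `X := H46 Y`, `s := BH·η·‖Y‖`
  have hΔ := norm_symm_DeltaEta_toL2_H46_le (h := h) hp hq h137 h139 Y ⟨x, μ⟩
  have h3 := h310 Fv (BH * eta F n K * ‖Y‖) (fun b => h46 Y b) ⟨x, μ⟩
  rw [← hFv] at hΔ
  -- `‖η⁻²•𝔠‖ ≤ ‖toL2⁻¹Δ^η(…)‖ + ‖toL2⁻¹Δ^η(…) − η⁻²•𝔠‖`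
  have hsc : ‖((((eta F n K)⁻¹ ^ 2 : ℝ) : ℂ)) • covCodiffCurlT 1 (bgUnits F K U₀) Fv μ x‖
      ≤ (c137 + c139) * eta F n K * ‖Y‖ + c369 * ε₀ * (BH * eta F n K * ‖Y‖) := by
    have htri := norm_sub_le_norm_sub_add_norm_sub
      (((((eta F n K)⁻¹ ^ 2 : ℝ) : ℂ)) • covCodiffCurlT 1 (bgUnits F K U₀) Fv μ x)
      ((toL2 F K c₀).symm (DeltaEta F n K c₀ U₀ (toL2 F K c₀ Fv)) ⟨x, μ⟩) (0 : Matrix (Fin 2) (Fin 2) ℂ)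
    rw [sub_zero, sub_zero, norm_sub_rev] at htri
    linarith
  have hηn : ‖((((eta F n K)⁻¹ ^ 2 : ℝ) : ℂ))‖ = (eta F n K)⁻¹ ^ 2 := by
    rw [Complex.norm_real, Real.norm_of_nonneg (by positivity)]
  rw [norm_smul, hηn] at hsc
  -- multiply through by `η²`
  have hη2 : 0 < eta F n K ^ 2 := by positivity
  have hkey : ‖covCodiffCurlT 1 (bgUnits F K U₀) Fv μ x‖
      ≤ eta F n K ^ 2 * ((c137 + c139) * eta F n K * ‖Y‖ + c369 * ε₀ * (BH * eta F n K * ‖Y‖)) := by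
    have := mul_le_mul_of_nonneg_left hsc hη2.le
    have hcancel : eta F n K ^ 2 * ((eta F n K)⁻¹ ^ 2 * ‖covCodiffCurlT 1 (bgUnits F K U₀) Fv μ x‖)
        = ‖covCodiffCurlT 1 (bgUnits F K U₀) Fv μ x‖ := by
      field_simp
    linarith [hcancel]
  calc ‖covCodiffCurlT 1 (bgUnits F K U₀) Fv μ x‖
      ≤ eta F n K ^ 2 * ((c137 + c139) * eta F n K * ‖Y‖ + c369 * ε₀ * (BH * eta F n K * ‖Y‖)) := hkey
    _ = (c137 + c139 + c369 * ε₀ * BH) * eta F n K ^ 3 * ‖Y‖ := by ring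

/-! ## §3 «|Δ_{U₀}HB|₍₋₃₎ ≦ O(1)|B|» — the second second-order member of (19) for `H46 Y`, via (140) and (135) -/

/-- ★★★ **`‖Δ¹_{U₀}(H46 Y)‖ ≤ (c₁₃₇ + c₁₃₉ + c₃₆₉·ε₀·BH + c₃₄₉ + 4·ε₀·BH)·η³·‖Y‖`** — print's «|Δ_{U₀}HB|₍₋₃₎ ≦ O(1)|B|» (p. 299 l.14) for the route letter:
§2 + (135) in the `nMax19` letters on the printed-regular class (✓`norm_covCodiffCurlT_sub_covLapFormT_add_gradDiv_le_of_regPr`: `‖D¹*D¹X − (Δ¹X − D¹(D¹*X))‖ ≤ 4ε₀η²·sup‖X‖`)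
+ the displayed (140)∕(3.49) row `h349` for `D¹(D¹*(H46 Y))` + (46)₀.
[cite: Balaban1985Variational, (140) p.299, (135) p.298, (19) p.281; Balaban1985BackgroundPropagators, (3.49) p.399] -/
theorem covLapFormT_H46_le {U₀ : GaugeField (F.P K) 0 (Matrix.specialUnitaryGroup (Fin 2) ℂ)} {ε₀ : ℝ} (hreg : RegPr F n K ε₀ U₀)
    (hp : PosOnto F n K h c₀ cB a (DeltaPiSlot F n K h c₀ cB a) U₀) (hq : PosPrime F n K h c₀ cB a U₀) {BH c137 c139 c369 c349 : ℝ}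
    (h46 : ∀ (Y : PBond (F.P n) 0 → Matrix (Fin 2) (Fin 2) ℂ) (b : PBond (F.P K) 0), ‖H46 F n K h c₀ cB a U₀ Y b‖ ≤ BH * eta F n K * ‖Y‖)
    (h137 : ∀ (Y : PBond (F.P n) 0 → Matrix (Fin 2) (Fin 2) ℂ) (b : PBond (F.P K) 0),
      ‖(toL2 F K c₀).symm (LinearMap.adjoint (Qk F n K h c₀ cB U₀) (KinvT F n K h c₀ cB a (DeltaPiSlot F n K h c₀ cB a) U₀ (toL2B F n cB Y))
          - LinearMap.adjoint (Qk F n K h c₀ cB U₀) (((a : ℂ)) • toL2B F n cB Y)) b‖ ≤ c137 * ‖Y‖)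
    (h139 : ∀ (Y : PBond (F.P n) 0 → Matrix (Fin 2) (Fin 2) ℂ) (b : PBond (F.P K) 0),
      ‖(toL2 F K c₀).symm (LinearMap.adjoint
          (DL2 F n K c₀ U₀ ∘ₗ GprimeT F n K h c₀ cB a U₀ ∘ₗ RS F n K h c₀ cB U₀ ∘ₗ DstarL2 F n K c₀ U₀)
          (DeltaEta F n K c₀ U₀ (toL2 F K c₀ (H46 F n K h c₀ cB a U₀ Y)))) b‖ ≤ c139 * eta F n K * ‖Y‖)
    (h310 : ∀ (X : PBond (F.P K) 0 → Matrix (Fin 2) (Fin 2) ℂ) (s : ℝ), (∀ b, ‖X b‖ ≤ s) → ∀ b : PBond (F.P K) 0,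
      ‖(toL2 F K c₀).symm (DeltaEta F n K c₀ U₀ (toL2 F K c₀ X)) b
          - ((((eta F n K)⁻¹ ^ 2 : ℝ) : ℂ)) • covCodiffCurlT 1 (bgUnits F K U₀) X b.dir b.src‖ ≤ c369 * ε₀ * s)
    (h349 : ∀ (Y : PBond (F.P n) 0 → Matrix (Fin 2) (Fin 2) ℂ) (μ : Fin (F.P K).d) (x : Site (F.P K) 0),
      ‖covDerivFwdT 1 (bgUnits F K U₀) μ (covDivFormT 1 (bgUnits F K U₀) (H46 F n K h c₀ cB a U₀ Y)) x‖ ≤ c349 * eta F n K ^ 3 * ‖Y‖)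
    (Y : PBond (F.P n) 0 → Matrix (Fin 2) (Fin 2) ℂ) (ν : Fin (F.P K).d) (x : Site (F.P K) 0) :
    ‖covLapFormT 1 (bgUnits F K U₀) (H46 F n K h c₀ cB a U₀ Y) ν x‖
      ≤ (c137 + c139 + c369 * ε₀ * BH + c349 + 4 * ε₀ * BH) * eta F n K ^ 3 * ‖Y‖ := by
  have hη : 0 < eta F n K := eta_pos F n K
  set Fv := H46 F n K h c₀ cB a U₀ Y with hFv
  have hDD := covCodiffCurlT_H46_le (h := h) hp hq h46 h137 h139 h310 Y ν x
  have hW := norm_covCodiffCurlT_sub_covLapFormT_add_gradDiv_le_of_regPr F n K U₀ hreg (X := Fv) (fun b => h46 Y b) ν x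
  have hG := h349 Y ν x
  rw [← hFv] at hDD hG
  -- `Δ¹X = D¹*D¹X + D¹(D¹*X) − (D¹*D¹X − (Δ¹X − D¹(D¹*X)))`
  have hdecomp : covLapFormT 1 (bgUnits F K U₀) Fv ν x
      = covCodiffCurlT 1 (bgUnits F K U₀) Fv ν x
        + covDerivFwdT 1 (bgUnits F K U₀) ν (covDivFormT 1 (bgUnits F K U₀) Fv) x
        - (covCodiffCurlT 1 (bgUnits F K U₀) Fv ν x
            - (covLapFormT 1 (bgUnits F K U₀) Fv ν x - covDerivFwdT 1 (bgUnits F K U₀) ν (covDivFormT 1 (bgUnits F K U₀) Fv) x)) := by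
    abel
  rw [hdecomp]
  calc ‖covCodiffCurlT 1 (bgUnits F K U₀) Fv ν x
        + covDerivFwdT 1 (bgUnits F K U₀) ν (covDivFormT 1 (bgUnits F K U₀) Fv) x
        - (covCodiffCurlT 1 (bgUnits F K U₀) Fv ν x
            - (covLapFormT 1 (bgUnits F K U₀) Fv ν x - covDerivFwdT 1 (bgUnits F K U₀) ν (covDivFormT 1 (bgUnits F K U₀) Fv) x))‖
      ≤ ‖covCodiffCurlT 1 (bgUnits F K U₀) Fv ν x‖
        + ‖covDerivFwdT 1 (bgUnits F K U₀) ν (covDivFormT 1 (bgUnits F K U₀) Fv) x‖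
        + ‖covCodiffCurlT 1 (bgUnits F K U₀) Fv ν x
            - (covLapFormT 1 (bgUnits F K U₀) Fv ν x - covDerivFwdT 1 (bgUnits F K U₀) ν (covDivFormT 1 (bgUnits F K U₀) Fv) x)‖ :=
        norm_sub_le_of_le (norm_add_le _ _) le_rfl
    _ ≤ (c137 + c139 + c369 * ε₀ * BH) * eta F n K ^ 3 * ‖Y‖ + c349 * eta F n K ^ 3 * ‖Y‖
        + 4 * ε₀ * eta F n K ^ 2 * (BH * eta F n K * ‖Y‖) := by
        gcongr
    _ = (c137 + c139 + c369 * ε₀ * BH + c349 + 4 * ε₀ * BH) * eta F n K ^ 3 * ‖Y‖ := by ring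

/-! ## §4 The row `hΔH` in the two-conjunct shape of record -/

/-- ★★★ **THE (S)-SUB-ROW `hΔH` FOR THE LETTER OF RECORD, FROM NAMED ROWS** — [Balaban1985Variational] (137)–(140) «`D*DH`, `Δ_{U₀}H` are bounded in the norm `|·|₍₋₃₎`» at the
T³ member: for every block field `Y`, `‖D¹*_{U₀}D¹_{U₀}(H46 Y)(b)‖ ≤ BH″·η³·‖Y‖` and `‖Δ¹_{U₀}(H46 Y)(b)‖ ≤ BH″·η³·‖Y‖` with `BH″ = c₁₃₇ + c₁₃₉ + c₃₄₉ + (c₃₆₉ + 4)·ε₀·BH`, on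
`RegPr ε₀ U₀ ∧ PosOnto ∧ PosPrime`, from the displayed rows (46)₀ `h46`, (137)-sup `h137`, (139) `h139`, (3.10)+(3.69) `h310`, (140)+(3.49) `h349` (each N06(d = 3)-class, named
above with its print locus and inhabitability line).  The shape is the EX-knit namer's confirmed currency for `hSize19′`'s second order at `H := H46 … U₀`.
[cite: Balaban1985Variational, (137)–(140) pp.298–299, (19) p.281, (45)–(46) p.285; Balaban1985BackgroundPropagators, (3.10) p.392, (3.49) p.399, (3.126) p.420] -/
theorem hΔH_of_rows {U₀ : GaugeField (F.P K) 0 (Matrix.specialUnitaryGroup (Fin 2) ℂ)} {ε₀ : ℝ} (hreg : RegPr F n K ε₀ U₀)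
    (hp : PosOnto F n K h c₀ cB a (DeltaPiSlot F n K h c₀ cB a) U₀) (hq : PosPrime F n K h c₀ cB a U₀) {BH c137 c139 c369 c349 : ℝ}
    (hε₀ : 0 ≤ ε₀) (hBH : 0 ≤ BH) (hc349 : 0 ≤ c349)
    (h46 : ∀ (Y : PBond (F.P n) 0 → Matrix (Fin 2) (Fin 2) ℂ) (b : PBond (F.P K) 0), ‖H46 F n K h c₀ cB a U₀ Y b‖ ≤ BH * eta F n K * ‖Y‖)
    (h137 : ∀ (Y : PBond (F.P n) 0 → Matrix (Fin 2) (Fin 2) ℂ) (b : PBond (F.P K) 0),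
      ‖(toL2 F K c₀).symm (LinearMap.adjoint (Qk F n K h c₀ cB U₀) (KinvT F n K h c₀ cB a (DeltaPiSlot F n K h c₀ cB a) U₀ (toL2B F n cB Y))
          - LinearMap.adjoint (Qk F n K h c₀ cB U₀) (((a : ℂ)) • toL2B F n cB Y)) b‖ ≤ c137 * ‖Y‖)
    (h139 : ∀ (Y : PBond (F.P n) 0 → Matrix (Fin 2) (Fin 2) ℂ) (b : PBond (F.P K) 0),
      ‖(toL2 F K c₀).symm (LinearMap.adjoint
          (DL2 F n K c₀ U₀ ∘ₗ GprimeT F n K h c₀ cB a U₀ ∘ₗ RS F n K h c₀ cB U₀ ∘ₗ DstarL2 F n K c₀ U₀)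
          (DeltaEta F n K c₀ U₀ (toL2 F K c₀ (H46 F n K h c₀ cB a U₀ Y)))) b‖ ≤ c139 * eta F n K * ‖Y‖)
    (h310 : ∀ (X : PBond (F.P K) 0 → Matrix (Fin 2) (Fin 2) ℂ) (s : ℝ), (∀ b, ‖X b‖ ≤ s) → ∀ b : PBond (F.P K) 0,
      ‖(toL2 F K c₀).symm (DeltaEta F n K c₀ U₀ (toL2 F K c₀ X)) b
          - ((((eta F n K)⁻¹ ^ 2 : ℝ) : ℂ)) • covCodiffCurlT 1 (bgUnits F K U₀) X b.dir b.src‖ ≤ c369 * ε₀ * s)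
    (h349 : ∀ (Y : PBond (F.P n) 0 → Matrix (Fin 2) (Fin 2) ℂ) (μ : Fin (F.P K).d) (x : Site (F.P K) 0),
      ‖covDerivFwdT 1 (bgUnits F K U₀) μ (covDivFormT 1 (bgUnits F K U₀) (H46 F n K h c₀ cB a U₀ Y)) x‖ ≤ c349 * eta F n K ^ 3 * ‖Y‖) :
    (∀ (Y : PBond (F.P n) 0 → Matrix (Fin 2) (Fin 2) ℂ) (μ : Fin (F.P K).d) (x : Site (F.P K) 0),
        ‖covCodiffCurlT 1 (bgUnits F K U₀) (H46 F n K h c₀ cB a U₀ Y) μ x‖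
          ≤ (c137 + c139 + c349 + (c369 + 4) * ε₀ * BH) * eta F n K ^ 3 * ‖Y‖) ∧
    (∀ (Y : PBond (F.P n) 0 → Matrix (Fin 2) (Fin 2) ℂ) (ν : Fin (F.P K).d) (x : Site (F.P K) 0),
        ‖covLapFormT 1 (bgUnits F K U₀) (H46 F n K h c₀ cB a U₀ Y) ν x‖
          ≤ (c137 + c139 + c349 + (c369 + 4) * ε₀ * BH) * eta F n K ^ 3 * ‖Y‖) := by
  have hη : 0 < eta F n K := eta_pos F n K
  refine ⟨fun Y μ x => ?_, fun Y ν x => ?_⟩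
  · have h1 := covCodiffCurlT_H46_le (h := h) hp hq h46 h137 h139 h310 Y μ x
    have hextra : 0 ≤ (c349 + 4 * ε₀ * BH) * eta F n K ^ 3 * ‖Y‖ := by positivity
    calc ‖covCodiffCurlT 1 (bgUnits F K U₀) (H46 F n K h c₀ cB a U₀ Y) μ x‖
        ≤ (c137 + c139 + c369 * ε₀ * BH) * eta F n K ^ 3 * ‖Y‖ := h1
      _ ≤ (c137 + c139 + c369 * ε₀ * BH) * eta F n K ^ 3 * ‖Y‖ + (c349 + 4 * ε₀ * BH) * eta F n K ^ 3 * ‖Y‖ :=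
          le_add_of_nonneg_right hextra
      _ = (c137 + c139 + c349 + (c369 + 4) * ε₀ * BH) * eta F n K ^ 3 * ‖Y‖ := by ring
  · have h2 := covLapFormT_H46_le (h := h) hreg hp hq h46 h137 h139 h310 h349 Y ν x
    calc ‖covLapFormT 1 (bgUnits F K U₀) (H46 F n K h c₀ cB a U₀ Y) ν x‖
        ≤ (c137 + c139 + c369 * ε₀ * BH + c349 + 4 * ε₀ * BH) * eta F n K ^ 3 * ‖Y‖ := h2
      _ = (c137 + c139 + c349 + (c369 + 4) * ε₀ * BH) * eta F n K ^ 3 * ‖Y‖ := by ring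

end Summit.QuantumFields.YangMills.Theorems.Prop7SectET3HDeltaHOfRows

end
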